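import Summits.Ventures.HSemireg.EmbeddedFirstOrderDeformationsCechObstruction
import Summits.Ventures.HSemireg.EmbeddedFirstOrderDeformationsSmoothSplitting

/-!
# Venture HSemireg — PROPOSITION K's Čech sentence LITERALLY: for a locally split thickened atlas the obstruction
# cochain is `θ̄_αβ|_{I_αβ}`, so `Z` lifts iff `(θ̄_αβ|_{I_αβ})` is a Čech coboundary

HONEST FRAMING.  Lean side of the computation cell `pub-hsemireg` (track «S4-PUSH» (ii), seat s4-prove-3 g5, second
route for (S5)); log `s4push/prove-3/ATTEMPT-9.md` (file III).  Plain commutative algebra over an abstract thickened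
atlas (`…CechObstruction`) whose chart and overlap thickenings carry ring SECTIONS (`σ_α`, and on `U_αβ` the two
restricted sections `σˡ_αβ`, `σʳ_αβ`) — the situation of PROPOSITION K: `X` smooth, `X_ξ|_{U_α} ≅ U_α[ε]`
(`…SmoothSplitting`: sections from formal smoothness), transitions `ψ_αβ = id + εθ_αβ`.  No Mathlib scheme, sheaf,
Čech-to-derived comparison, abelian variety or semiregularity map is constructed; nothing here says that HC, HC_CM or
HC_AV holds; no object is certified; no Literature fact is declared.

WHAT (namespace `Summit.Ventures.HSemireg.EmbeddedDeformation`):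
* `cechCochain_eq_derivToNormal` — with the trivial local lifts `T_α := σ_α(I_α)·A'_α`, Hartshorne's cochain
  `T_β| − T_α|` IS `θ̄_αβ|_{I_αβ} : x ↦ θ_αβ(x) mod I_αβ`, where `θ_αβ := θ(σˡ_αβ, σʳ_αβ)` is the transition derivation of
  the two sections on the overlap (`…SmoothSplitting`: `e·σˡ(θ_αβ a) = σʳ a − σˡ a`, `τ_{σˡ}⁻¹ ∘ τ_{σʳ} = twist θ_αβ`, i.e.
  `ψ_αβ = id + εθ_αβ`; `diff_map_section`);
* **`exists_isAtlasLift_iff_derivToNormal`** — PROP. K: `Z` lifts to the thickened atlas `X_ξ` iff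
  `θ̄_αβ|_{I_αβ} = φ_β|_{αβ} − φ_α|_{αβ}` for some normal vectors `φ_α` («`Z` extends flatly along `A_ξ` ⟺ the Čech
  cocycle `(π(θ_αβ))` is a coboundary in `H¹(Z, 𝒩)`», Čech level).
* §2 `sectionLocalization` / `locMap_sectionLocalization` / `sectionLocalization_comp` — a chart section `σ` RESTRICTS
  to a section `σ_T` of the localised thickening over a basic open (`σ(π s) = s + e w` is a unit in `R'_T`; universal
  property of localisation), compatible with `σ` — the overlap sections `σˡ, σʳ` (`σʳ = ψ_αβ ∘ σ_T`,
  `section_comp_ringEquiv`) and the hypotheses `cl, cr` for atlases whose overlaps are basic opens.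
NOT typed: `(θ_αβ) ↦ ξ ∈ H¹(X, T_X)`; Čech vs. sheaf cohomology; refinement of covers.

References: R. Hartshorne, *Deformation Theory*, GTM 257 (2010), §6 Thm. 6.2 (b) [corpus:
book:springernd-deformation-theory p0054/p0056]; §2 Ex. 5.2, §4 Cor. 4.8 (local triviality over a nonsingular affine).
-/

namespace Summit.Ventures.HSemireg

namespace EmbeddedDeformation

universe w u u'

section SplitAtlas

variable {ι : Type w}
variable {A' A : ι → Type u} [∀ α, CommRing (A' α)] [∀ α, CommRing (A α)]
variable {A'₂ A₂ : ι → ι → Type u'} [∀ α β, CommRing (A'₂ α β)] [∀ α β, CommRing (A₂ α β)]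
variable {π : ∀ α, A' α →+* A α} {e : ∀ α, A' α} {π₂ : ∀ α β, A'₂ α β →+* A₂ α β} {e₂ : ∀ α β, A'₂ α β}
variable {ρl : ∀ α β, A' α →+* A'₂ α β} {rl : ∀ α β, A α →+* A₂ α β}
variable {ρr : ∀ α β, A' β →+* A'₂ α β} {rr : ∀ α β, A β →+* A₂ α β}
variable {I : ∀ α, Ideal (A α)} {I₂ : ∀ α β, Ideal (A₂ α β)}

/-- **The trivial local lifts** `T_α := σ_α(I_α)·A'_α` given by the chart sections (`…Cocycle`, `isLift_map_section`;
«extensions exist locally» holds on a locally split thickening). [cite: Hartshorne2010, §4 Cor. 4.8 / §6 Thm. 6.2] -/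
theorem isLift_map_chartSection (𝔄 : ThickenedAtlas π e π₂ e₂ ρl rl ρr rr I I₂) (σ : ∀ α, A α →+* A' α)
    (hσ : ∀ α a, π α (σ α a) = a) : ∀ α, IsLift (π α) (e α) (I α) ((I α).map (σ α)) :=
  fun α ↦ isLift_map_section (𝔄.thick α) (σ α) (hσ α) (I α)

/-- If the chart section restricts to the overlap section (`ρˡ_αβ ∘ σ_α = σˡ_αβ ∘ rˡ_αβ`), the trivial lift restricts to
the trivial lift: `T_α|_{αβ} = σˡ_αβ(I_αβ)·A'_αβ`. [folklore] -/
theorem map_trivialLift_left (𝔄 : ThickenedAtlas π e π₂ e₂ ρl rl ρr rr I I₂) (σ : ∀ α, A α →+* A' α)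
    (hσ : ∀ α a, π α (σ α a) = a) (σl : ∀ α β, A₂ α β →+* A'₂ α β)
    (cl : ∀ α β, (ρl α β).comp (σ α) = (σl α β).comp (rl α β)) (α β : ι) :
    ((I α).map (σ α)).map (ρl α β) = (I₂ α β).map (σl α β) := by
  rw [Ideal.map_map, cl, ← Ideal.map_map,
    (𝔄.liftsl α β).map_eq (𝔄.homl α β) (isLift_map_chartSection 𝔄 σ hσ α)]

/-- Likewise on the right: `T_β|_{αβ} = σʳ_αβ(I_αβ)·A'_αβ`. [folklore] -/
theorem map_trivialLift_right (𝔄 : ThickenedAtlas π e π₂ e₂ ρl rl ρr rr I I₂) (σ : ∀ α, A α →+* A' α)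
    (hσ : ∀ α a, π α (σ α a) = a) (σr : ∀ α β, A₂ α β →+* A'₂ α β)
    (cr : ∀ α β, (ρr α β).comp (σ β) = (σr α β).comp (rr α β)) (α β : ι) :
    ((I β).map (σ β)).map (ρr α β) = (I₂ α β).map (σr α β) := by
  rw [Ideal.map_map, cr, ← Ideal.map_map,
    (𝔄.liftsr α β).map_eq (𝔄.homr α β) (isLift_map_chartSection 𝔄 σ hσ β)]

variable (𝔄 : ThickenedAtlas π e π₂ e₂ ρl rl ρr rr I I₂)
variable (σ : ∀ α, A α →+* A' α) (hσ : ∀ α a, π α (σ α a) = a)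
variable (σl : ∀ α β, A₂ α β →+* A'₂ α β) (hσl : ∀ α β a, π₂ α β (σl α β a) = a)
variable (σr : ∀ α β, A₂ α β →+* A'₂ α β) (hσr : ∀ α β a, π₂ α β (σr α β a) = a)

/-- **The obstruction cochain of a locally split thickened atlas is `θ̄_αβ|_{I_αβ}`**: with the trivial local lifts,
`T_β|_{αβ} − T_α|_{αβ} = (x ↦ θ_αβ(x) mod I_αβ)`, `θ_αβ = θ(σˡ_αβ, σʳ_αβ)` the transition derivation of the two sections
on the overlap (`ψ_αβ = τ_{σˡ}⁻¹ τ_{σʳ} = id + εθ_αβ` carries `J_φ` to `J_{φ + θ̄_αβ|_I}`).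
[cite: Hartshorne2010, §6 proof of Thm. 6.2 (b)] -/
theorem cechCochain_eq_derivToNormal (cl : ∀ α β, (ρl α β).comp (σ α) = (σl α β).comp (rl α β))
    (cr : ∀ α β, (ρr α β).comp (σ β) = (σr α β).comp (rr α β)) (α β : ι) :
    cechCochain 𝔄 (isLift_map_chartSection 𝔄 σ hσ) α β =
      derivToNormal (I₂ α β)
        ((𝔄.thick₂ α β).transitionDerivation (σl α β) (σr α β) (hσl α β) (hσr α β)) := by
  rw [cechCochain, IsLift.diff_congr (𝔄.thick₂ α β) (𝔄.liftsl α β (isLift_map_chartSection 𝔄 σ hσ α))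
    (𝔄.liftsr α β (isLift_map_chartSection 𝔄 σ hσ β))
    (isLift_map_section (𝔄.thick₂ α β) (σl α β) (hσl α β) (I₂ α β))
    (isLift_map_section (𝔄.thick₂ α β) (σr α β) (hσr α β) (I₂ α β))
    (map_trivialLift_left 𝔄 σ hσ σl cl α β) (map_trivialLift_right 𝔄 σ hσ σr cr α β),
    (𝔄.thick₂ α β).diff_map_section]

/-- **PROPOSITION K (Čech sentence), locally split thickened atlas.**  `Z = (I_α)` lifts to the thickened atlas — a
compatible family of local flat lifts exists — IF AND ONLY IF the Čech cochain `(θ̄_αβ|_{I_αβ})` of the transition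
derivations is a COBOUNDARY of normal vectors: `θ̄_αβ|_{I_αβ} = φ_β|_{αβ} − φ_α|_{αβ}` (Hartshorne Thm. 6.2 (b) with
the trivial local lifts as the local choices). [cite: Hartshorne2010, §6 Thm. 6.2 (b)] -/
theorem exists_isAtlasLift_iff_derivToNormal (cl : ∀ α β, (ρl α β).comp (σ α) = (σl α β).comp (rl α β))
    (cr : ∀ α β, (ρr α β).comp (σ β) = (σr α β).comp (rr α β)) :
    (∃ K : ∀ α, Ideal (A' α), IsAtlasLift π e ρl ρr I K) ↔
      ∃ φ : ∀ α, I α →ₗ[A α] A α ⧸ I α, ∀ α β,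
        derivToNormal (I₂ α β) ((𝔄.thick₂ α β).transitionDerivation (σl α β) (σr α β) (hσl α β) (hσr α β)) =
          resR 𝔄 (isLift_map_chartSection 𝔄 σ hσ) α β (φ β) - resL 𝔄 (isLift_map_chartSection 𝔄 σ hσ) α β (φ α) := by
  rw [exists_isAtlasLift_iff 𝔄 (isLift_map_chartSection 𝔄 σ hσ)]
  simp only [cechCochain_eq_derivToNormal 𝔄 σ hσ σl hσl σr hσr cl cr]

/-- The value of the obstruction cochain on an element: `c_αβ(x) = θ_αβ(x) mod I_αβ`, where `θ_αβ(x)` is pinned by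
`e_αβ · σˡ_αβ(θ_αβ x) = σʳ_αβ x − σˡ_αβ x` (`…SmoothSplitting`, `eps_mul_section_transitionDerivation`).
[cite: Hartshorne2010, §6 proof of Thm. 6.2 (b)] -/
theorem cechCochain_apply (cl : ∀ α β, (ρl α β).comp (σ α) = (σl α β).comp (rl α β))
    (cr : ∀ α β, (ρr α β).comp (σ β) = (σr α β).comp (rr α β)) (α β : ι) (x : I₂ α β) :
    cechCochain 𝔄 (isLift_map_chartSection 𝔄 σ hσ) α β x =
      Ideal.Quotient.mk (I₂ α β)
        ((𝔄.thick₂ α β).transitionDerivation (σl α β) (σr α β) (hσl α β) (hσr α β) x) := by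
  rw [cechCochain_eq_derivToNormal 𝔄 σ hσ σl hσl σr hσr cl cr, derivToNormal_apply]

end SplitAtlas

/-! ### §2 Chart sections restrict to basic opens (the overlap sections `σˡ, σʳ` and `cl, cr` for localisation atlases) -/

section SectionLocalization

variable {R' : Type u} {R : Type u'} [CommRing R'] [CommRing R] {π : R' →+* R} {e : R'}
variable (T : Submonoid R') (R'ₜ : Type u) [CommRing R'ₜ] [Algebra R' R'ₜ] [IsLocalization T R'ₜ]
variable (Rₜ : Type u') [CommRing Rₜ] [Algebra R Rₜ] [IsLocalization (T.map π) Rₜ]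

/-- A section `σ` of a flat first-order thickening sends the elements `π(s)`, `s ∈ T`, to UNITS of `R'_T`:
`σ(π s) = s + e w` is a unit plus a square-zero element. [folklore] -/
theorem isUnit_algebraMap_section (hT : IsFirstOrderThickening π e) (σ : R →+* R') (hσ : ∀ a, π (σ a) = a)
    (y : T.map π) : IsUnit (((algebraMap R' R'ₜ).comp σ) y) := by
  obtain ⟨s, hs⟩ := exists_eq_map_of_mem_map T y.2
  obtain ⟨w, hw⟩ := hT.exists_eq_add_eps_mul (show π (σ y) = π s by rw [hσ, hs])
  rw [RingHom.comp_apply, hw, map_add]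
  refine IsNilpotent.isUnit_add_left_of_commute ⟨2, ?_⟩ (IsLocalization.map_units R'ₜ s) (Commute.all _ _)
  rw [pow_two, ← map_mul, show e * w * (e * w) = e * e * (w * w) by ring, hT.eps_sq, zero_mul, map_zero]

/-- **The chart section restricted to the basic open `Spec R'_T`**: `σ_T : R_{π(T)} → R'_T`, the unique ring map with
`σ_T(a/1) = σ(a)/1` (universal property of localisation; the denominators become units by
`isUnit_algebraMap_section`). [folklore] -/
noncomputable def sectionLocalization (hT : IsFirstOrderThickening π e) (σ : R →+* R') (hσ : ∀ a, π (σ a) = a) :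
    Rₜ →+* R'ₜ :=
  IsLocalization.lift (M := T.map π) (g := (algebraMap R' R'ₜ).comp σ) (isUnit_algebraMap_section T R'ₜ hT σ hσ)

/-- Compatibility with the chart section: `σ_T ∘ (R → R_{π T}) = (R' → R'_T) ∘ σ` — hypothesis `cl`/`cr` of the split
atlas for basic-open overlaps. [folklore] -/
theorem sectionLocalization_comp (hT : IsFirstOrderThickening π e) (σ : R →+* R') (hσ : ∀ a, π (σ a) = a) :
    (sectionLocalization T R'ₜ Rₜ hT σ hσ).comp (algebraMap R Rₜ) = (algebraMap R' R'ₜ).comp σ :=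
  IsLocalization.lift_comp _

/-- **`σ_T` is a section of the localised thickening** `πₜ : R'_T ↠ R_{π(T)}` (both `πₜ ∘ σ_T` and the identity
extend `R → R_{π T}`). [folklore] -/
theorem locMap_sectionLocalization (hT : IsFirstOrderThickening π e) (σ : R →+* R') (hσ : ∀ a, π (σ a) = a)
    (z : Rₜ) : locMap π T R'ₜ Rₜ (sectionLocalization T R'ₜ Rₜ hT σ hσ z) = z := by
  have h : (locMap π T R'ₜ Rₜ).comp (sectionLocalization T R'ₜ Rₜ hT σ hσ) = RingHom.id Rₜ := by
    refine IsLocalization.ringHom_ext (T.map π) ?_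
    rw [RingHom.comp_assoc, sectionLocalization_comp, RingHom.id_comp]
    ext a
    rw [RingHom.comp_apply, RingHom.comp_apply, locMap_algebraMap, hσ]
  exact RingHom.congr_fun h z

/-- Post-composing a section with an automorphism of the thickening over the base (a transition isomorphism
`ψ_αβ`) gives a section — the right-hand overlap section `σʳ = ψ ∘ σ_T` of a twisted atlas. [folklore] -/
theorem section_comp_ringEquiv {S' : Type u} {S : Type u'} [CommRing S'] [CommRing S] {τ : S' →+* S}
    (ψ : S' ≃+* S') (hψ : ∀ z, τ (ψ z) = τ z) (σ₂ : S →+* S') (hσ₂ : ∀ a, τ (σ₂ a) = a) (a : S) :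
    τ (((ψ : S' →+* S').comp σ₂) a) = a := by
  rw [RingHom.comp_apply, RingHom.coe_coe, hψ, hσ₂]

end SectionLocalization

end EmbeddedDeformation

end Summit.Ventures.HSemireg
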